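import Mathlib
import Summits.ValiantsHypothesis.ValiantsHypothesis.Theorems.BarrierLeverTransversalMinorLayoutsCompressionBase

/-!
# Route BarrierLever — conjecture TT (stmt-ValiantsHypothesis-19152): PARABOLIC certificates,
# part 2 — the glue (N) ∧ (P) ⇒ TT

Seat val-np-p2 gen 3 (memo HOME/val-np-p2/MEMO-p2g3.md §5; statements (P) `ParabolicTT` and (N)
`NestedTranslates` of HOME/val-np-p2/GTConjecture-g3.lean, here spelled out as hypotheses).
(P): nested cardinality tails ⇒ a parabolic matrix makes the `ρ`-`ρ` pairing of two injective
families nonsingular.  (N): any two injective families of equal size admit cube translations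
`S, S'` with nested tails.  THIS FILE: (N) ∧ (P) ⇒ `TransversalMinorLayoutsNonsingular` — the item's
column transversal `τ_w` IS `ρ_{wᶜ}` entrywise, translations are one-sided relabelings by the
literal flips `flipPerm S` (`pairing_good_unrelabel_rows/cols`), and the orientation in which the
column side dominates is handled by transposition (`pairing_good_comm`).

Definition-free (the flip permutation is built inline), Mathlib + part 1 of the compression files.
WHAT THIS IS NOT: (P) and (N) are OPEN (censuses: memo §5, kit j255171 / j255303); no proof of TT;
nothing on crux 14610 or VP versus VNP.
-/

-- layout Summits/ValiantsHypothesis/ValiantsHypothesis forces the duplicated namespace component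
set_option linter.dupNamespace false

open Matrix Finset

namespace Summit.ValiantsHypothesis.ValiantsHypothesis.Theorems.BarrierLever.Compression

variable {κ α ι : Type*} [Fintype κ] [DecidableEq κ] [Fintype α] [DecidableEq α] [DecidableEq ι]

/-! ## 1. One-sided relabelings -/

omit [DecidableEq ι] in
/-- Un-relabeling the ROW family: if `(π ∘ F, F')` is good then `(F, F')` is good
(`g ↦ g` with rows permuted by `π`). -/
theorem pairing_good_unrelabel_rows (F F' : κ → α → ι) (π : Equiv.Perm ι)
    (hg : ∃ g : Matrix ι ι ℂ,
      (Matrix.of fun j i => (g.submatrix (fun a => π (F j a)) (F' i)).det).det ≠ 0) :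
    ∃ g : Matrix ι ι ℂ, (Matrix.of fun j i => (g.submatrix (F j) (F' i)).det).det ≠ 0 := by
  obtain ⟨g, hg⟩ := hg
  refine ⟨g.submatrix π id, ?_⟩
  have : (Matrix.of fun j i => ((g.submatrix ⇑π id).submatrix (F j) (F' i)).det) =
      Matrix.of fun j i => (g.submatrix (fun a => π (F j a)) (F' i)).det := by
    ext j i
    rfl
  rw [this]; exact hg

omit [DecidableEq ι] in
/-- Un-relabeling the COLUMN family. -/
theorem pairing_good_unrelabel_cols (F F' : κ → α → ι) (π : Equiv.Perm ι)
    (hg : ∃ g : Matrix ι ι ℂ,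
      (Matrix.of fun j i => (g.submatrix (F j) (fun b => π (F' i b))).det).det ≠ 0) :
    ∃ g : Matrix ι ι ℂ, (Matrix.of fun j i => (g.submatrix (F j) (F' i)).det).det ≠ 0 := by
  obtain ⟨g, hg⟩ := hg
  refine ⟨g.submatrix id π, ?_⟩
  have : (Matrix.of fun j i => ((g.submatrix id ⇑π).submatrix (F j) (F' i)).det) =
      Matrix.of fun j i => (g.submatrix (F j) (fun b => π (F' i b))).det := by
    ext j i
    rfl
  rw [this]; exact hg

/-! ## 2. The literal flip at a set of coordinates -/

/-- The literal flip at the coordinates in `S`: `castAdd h a ↔ natAdd h a` for `a ∈ S`, identity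
elsewhere (as a function on `Fin (h + h)`). -/
theorem flip_involutive (h : ℕ) (S : Finset (Fin h)) :
    Function.Involutive (fun x : Fin (h + h) =>
      Fin.addCases (fun a : Fin h => if a ∈ S then Fin.natAdd h a else Fin.castAdd h a)
        (fun a : Fin h => if a ∈ S then Fin.castAdd h a else Fin.natAdd h a) x) := by
  intro x
  refine Fin.addCases (fun a => ?_) (fun a => ?_) x
  · by_cases ha : a ∈ S
    · simp only [Fin.addCases_left, if_pos ha, Fin.addCases_right]
    · simp only [Fin.addCases_left, if_neg ha]
  · by_cases ha : a ∈ S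
    · simp only [Fin.addCases_right, if_pos ha, Fin.addCases_left]
    · simp only [Fin.addCases_right, if_neg ha]

/-- The row transversal of a translated set `u ∆ S` is the flipped row transversal of `u`. -/
theorem rowT_symmDiff (h : ℕ) (S u : Finset (Fin h)) (b : Fin h) :
    (if b ∈ symmDiff u S then Fin.castAdd h b else Fin.natAdd h b) =
      (Function.Involutive.toPerm _ (flip_involutive h S))
        (if b ∈ u then Fin.castAdd h b else Fin.natAdd h b) := by
  rw [Function.Involutive.coe_toPerm]
  by_cases hb : b ∈ u <;> by_cases hS : b ∈ S
  · have hm : b ∉ symmDiff u S := by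
      rw [Finset.mem_symmDiff]; push Not; exact ⟨fun _ => hS, fun _ => hb⟩
    rw [if_neg hm, if_pos hb, Fin.addCases_left, if_pos hS]
  · have hm : b ∈ symmDiff u S := Finset.mem_symmDiff.mpr (Or.inl ⟨hb, hS⟩)
    rw [if_pos hm, if_pos hb, Fin.addCases_left, if_neg hS]
  · have hm : b ∈ symmDiff u S := Finset.mem_symmDiff.mpr (Or.inr ⟨hS, hb⟩)
    rw [if_pos hm, if_neg hb, Fin.addCases_right, if_pos hS]
  · have hm : b ∉ symmDiff u S := by
      rw [Finset.mem_symmDiff]; push Not; exact ⟨fun h' => absurd h' hb, fun h' => absurd h' hS⟩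
    rw [if_neg hm, if_neg hb, Fin.addCases_right, if_neg hS]

/-! ## 3. The glue -/

/-- **(N) ∧ (P) ⇒ TT.**  If every two injective families admit translations with nested
cardinality tails (N), and nested tails yield a parabolic certificate for the `ρ`-`ρ` pairing (P),
then `TransversalMinorLayoutsNonsingular` (item 19152) holds. -/
theorem transversalMinorLayoutsNonsingular_of_nestedTranslates_of_parabolic
    (N : ∀ (h r : ℕ) (U W : Fin r → Finset (Fin h)), Function.Injective U →
      Function.Injective W → ∃ S S' : Finset (Fin h),
        (∀ t : ℕ, (Finset.univ.filter fun j => t ≤ (symmDiff (W j) S').card).card ≤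
            (Finset.univ.filter fun i => t ≤ (symmDiff (U i) S).card).card) ∨
        (∀ t : ℕ, (Finset.univ.filter fun i => t ≤ (symmDiff (U i) S).card).card ≤
            (Finset.univ.filter fun j => t ≤ (symmDiff (W j) S').card).card))
    (P : ∀ (h r : ℕ) (U W : Fin r → Finset (Fin h)), Function.Injective U →
      Function.Injective W →
      (∀ t : ℕ, (Finset.univ.filter fun j => t ≤ (W j).card).card ≤
        (Finset.univ.filter fun i => t ≤ (U i).card).card) →
      ∃ g : Matrix (Fin (h + h)) (Fin (h + h)) ℂ,
        (∀ a c : Fin h, g (Fin.natAdd h a) (Fin.castAdd h c) = 0) ∧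
        (Matrix.of fun i j : Fin r => (g.submatrix
          (fun b : Fin h => if b ∈ U i then Fin.castAdd h b else Fin.natAdd h b)
          (fun b : Fin h => if b ∈ W j then Fin.castAdd h b else Fin.natAdd h b)).det).det ≠ 0) :
    Theses.BarrierLever.TransversalMinorLayoutsNonsingular := by
  classical
  intro h r u w hu hw
  -- the column transversal τ_w is ρ_{wᶜ}
  have hcol : ∀ j, (fun c : Fin h => if c ∈ w j then Fin.natAdd h c else Fin.castAdd h c) =
      (fun c : Fin h => if c ∈ (w j)ᶜ then Fin.castAdd h c else Fin.natAdd h c) := by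
    intro j; funext c
    by_cases hc : c ∈ w j
    · rw [if_pos hc, if_neg (by simpa using hc)]
    · rw [if_neg hc, if_pos (Finset.mem_compl.mpr hc)]
  have hwc : Function.Injective (fun j => (w j)ᶜ) := by
    intro j j' hjj'
    exact hw (compl_injective hjj')
  simp only [hcol]
  -- translate both sides into nested position
  obtain ⟨S, S', hnest⟩ := N h r u (fun j => (w j)ᶜ) hu hwc
  have huS : Function.Injective (fun i => symmDiff (u i) S) := by
    intro i i' hii'
    exact hu (symmDiff_left_injective S hii')
  have hwS : Function.Injective (fun j => symmDiff ((w j)ᶜ) S') := by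
    intro j j' hjj'
    exact hwc (symmDiff_left_injective S' hjj')
  -- un-translate: rows by the flip at S, columns by the flip at S'
  refine pairing_good_unrelabel_rows
    (fun (i : Fin r) (b : Fin h) => if b ∈ u i then Fin.castAdd h b else Fin.natAdd h b)
    (fun (j : Fin r) (c : Fin h) => if c ∈ (w j)ᶜ then Fin.castAdd h c else Fin.natAdd h c)
    (Function.Involutive.toPerm _ (flip_involutive h S)) ?_
  refine pairing_good_unrelabel_cols _ _ (Function.Involutive.toPerm _ (flip_involutive h S')) ?_
  have hrows : ∀ (i : Fin r) (b : Fin h), (Function.Involutive.toPerm _ (flip_involutive h S))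
      (if b ∈ u i then Fin.castAdd h b else Fin.natAdd h b) =
      (if b ∈ symmDiff (u i) S then Fin.castAdd h b else Fin.natAdd h b) :=
    fun i b => (rowT_symmDiff h S (u i) b).symm
  have hcols : ∀ (j : Fin r) (c : Fin h), (Function.Involutive.toPerm _ (flip_involutive h S'))
      (if c ∈ (w j)ᶜ then Fin.castAdd h c else Fin.natAdd h c) =
      (if c ∈ symmDiff ((w j)ᶜ) S' then Fin.castAdd h c else Fin.natAdd h c) :=
    fun j c => (rowT_symmDiff h S' ((w j)ᶜ) c).symm
  simp only [hrows, hcols]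
  rcases hnest with hUdom | hWdom
  · obtain ⟨g, _, hg⟩ := P h r (fun i => symmDiff (u i) S) (fun j => symmDiff ((w j)ᶜ) S')
      huS hwS hUdom
    exact ⟨g, hg⟩
  · obtain ⟨g, _, hg⟩ := P h r (fun j => symmDiff ((w j)ᶜ) S') (fun i => symmDiff (u i) S)
      hwS huS hWdom
    exact (pairing_good_comm _ _).mpr ⟨g, hg⟩

end Summit.ValiantsHypothesis.ValiantsHypothesis.Theorems.BarrierLever.Compression
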